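import Literature.NumberTheory.LFunctions.Zhang2022.KnifeEdgeLenZDegreeMinors

/-!
# Zhang (2022), rung F-S3 (Landau–Siegel programme, §D edge len = E*-len⁺): route `ZDegreeToeplitzBand`, item α1 —
# KERNEL-FORM pair functionals: the shapes a closed-form table `X₁^ψ, Y₁^ψ, X₂^ψ` can take (double profile integrals against
# a kernel, boundary point terms, single integrals × point values) are `PairHomogeneous`, hence pass the α1 junk guard
# (`VanishesOnZero`) — PROVED once and for all, with closure under `+` and scalars, so the census formulas land as one-liners

Y. Zhang, *Discrete mean estimates and the Landau–Siegel zero*, arXiv:2211.02515v1 [Zhang2022LandauSiegel] — an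
unrefereed manuscript under adjudication. **WHAT THIS IS NOT: not a claim about Theorems 1–2 of arXiv:2211.02515, about
Landau–Siegel zeros, or about Parity. The programme SEARCHES and TYPES; no claim about Landau–Siegel zeros, Theorems 1–2 of
arXiv:2211.02515 or a repaired Margin232 until a kernel theorem says so.** No table of the route is DEFINED here (that is item
α1, pending the archimedean census of the F2 recipe); this file only fixes the admissible SHAPES and proves their homogeneity, in
the pattern of Zhang's own main-term form `𝔅` (`mainTermForm_eq`: `∫|g′|²`, `Im∫g′·conj g`, `∫|g|²`, `Im∫g·conj∫g`,
`Re(conj∫g·(g0+g1))`, `Im(g0·conj g1)` — double/single integrals and endpoint values, all sesquilinear).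

WHY (cell landau-siegel §D; critic ls-knife-crit-1 C0 03:00:20Z junk guard; C0 CONFIRM pin (b) «α1 defs carry
`KnifeEdge.VanishesOnZero`»): `KnifeEdgeLenZDegreeMinors.vanishesOnZero_of_pairHomogeneous` reduces the guard to
`PairHomogeneous`; here `PairHomogeneous` is proved for `kernelPair` (four kernels against `(f,g), (f,g′), (f′,g), (f′,g′)`),
`pointPair` (endpoint × endpoint), `leftIntegralPoint` / `pointRightIntegral` (integral × endpoint), and preserved by `+`, `•`,
finite sums — with NO integrability hypothesis (constants pull out of interval integrals unconditionally).

## References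
* Y. Zhang, arXiv:2211.02515v1 (2022), §7 Prop. 7.1 (7.2), §8 (8.5). [cite: Zhang2022LandauSiegel, §7 Prop 7.1 (7.2), §8 (8.5)]
-/

noncomputable section

open Complex Real ComplexConjugate

namespace Literature.NumberTheory.LFunctions.Zhang2022.KnifeEdge

open Repair Skeleton

section KernelForms

/-- **Kernel-form pair functional:** `X(f,f′;g,g′) = ∫₀^{θ₁}∫₀^{θ₂} (K₀₀(x,y)f(x)conj g(y) + K₀₁ f(x)conj g′(y) +
K₁₀ f′(x)conj g(y) + K₁₁ f′(x)conj g′(y)) dy dx` — the generic shape of a main-term table between two profile pieces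
(cf. the integral terms of `mainTermForm_eq`). [cite: Zhang2022LandauSiegel, §7 Prop 7.1 (7.2)] -/
def kernelPair (θ₁ θ₂ : ℝ) (K₀₀ K₀₁ K₁₀ K₁₁ : ℝ → ℝ → ℂ) : PairFunctional := fun f f' g g' =>
  ∫ x in (0:ℝ)..θ₁, ∫ y in (0:ℝ)..θ₂,
    (K₀₀ x y * f x * conj (g y) + K₀₁ x y * f x * conj (g' y) + K₁₀ x y * f' x * conj (g y) + K₁₁ x y * f' x * conj (g' y))

/-- **Endpoint × endpoint term:** `X(f,f′;g,g′) = w·f(x₀)·conj g(y₀)` (cf. `16·Im(g0·conj g1)` in `𝔅`).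
[cite: Zhang2022LandauSiegel, §7 Prop 7.1 (7.2)] -/
def pointPair (w : ℂ) (x₀ y₀ : ℝ) : PairFunctional := fun f _ g _ => w * f x₀ * conj (g y₀)

/-- **Integral × endpoint term:** `X = (∫₀^{θ} k(x)f(x)dx)·conj g(y₀)` (cf. `Re(conj∫g·(g0+g1))` in `𝔅`).
[cite: Zhang2022LandauSiegel, §7 Prop 7.1 (7.2)] -/
def leftIntegralPoint (θ : ℝ) (k : ℝ → ℂ) (y₀ : ℝ) : PairFunctional := fun f _ g _ =>
  (∫ x in (0:ℝ)..θ, k x * f x) * conj (g y₀)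

/-- **Endpoint × integral term:** `X = f(x₀)·conj(∫₀^{θ} k(y)g(y)dy)`. [cite: Zhang2022LandauSiegel, §7 Prop 7.1 (7.2)] -/
def pointRightIntegral (x₀ θ : ℝ) (k : ℝ → ℂ) : PairFunctional := fun f _ g _ =>
  f x₀ * conj (∫ y in (0:ℝ)..θ, k y * g y)

/-- `kernelPair` is pair-homogeneous (no integrability needed: scalars pull out of interval integrals unconditionally).
[cite: Zhang2022LandauSiegel, §7 Prop 7.1 (7.2)] -/
theorem pairHomogeneous_kernelPair (θ₁ θ₂ : ℝ) (K₀₀ K₀₁ K₁₀ K₁₁ : ℝ → ℝ → ℂ) :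
    PairHomogeneous (kernelPair θ₁ θ₂ K₀₀ K₀₁ K₁₀ K₁₁) := by
  refine ⟨fun c a a' b b' => ?_, fun c a a' b b' => ?_⟩
  · simp only [kernelPair, Pi.smul_apply, smul_eq_mul]
    rw [← intervalIntegral.integral_const_mul]
    refine intervalIntegral.integral_congr fun x _ => ?_
    rw [← intervalIntegral.integral_const_mul]
    refine intervalIntegral.integral_congr fun y _ => ?_
    ring
  · simp only [kernelPair, Pi.smul_apply, smul_eq_mul, map_mul]
    rw [← intervalIntegral.integral_const_mul]
    refine intervalIntegral.integral_congr fun x _ => ?_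
    rw [← intervalIntegral.integral_const_mul]
    refine intervalIntegral.integral_congr fun y _ => ?_
    ring

/-- `pointPair` is pair-homogeneous. [cite: Zhang2022LandauSiegel, §7 Prop 7.1 (7.2)] -/
theorem pairHomogeneous_pointPair (w : ℂ) (x₀ y₀ : ℝ) : PairHomogeneous (pointPair w x₀ y₀) := by
  refine ⟨fun c a a' b b' => ?_, fun c a a' b b' => ?_⟩
  · simp only [pointPair, Pi.smul_apply, smul_eq_mul]; ring
  · simp only [pointPair, Pi.smul_apply, smul_eq_mul, map_mul]; ring

/-- `leftIntegralPoint` is pair-homogeneous. [cite: Zhang2022LandauSiegel, §7 Prop 7.1 (7.2)] -/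
theorem pairHomogeneous_leftIntegralPoint (θ : ℝ) (k : ℝ → ℂ) (y₀ : ℝ) :
    PairHomogeneous (leftIntegralPoint θ k y₀) := by
  refine ⟨fun c a a' b b' => ?_, fun c a a' b b' => ?_⟩
  · simp only [leftIntegralPoint, Pi.smul_apply, smul_eq_mul]
    rw [show (fun x => k x * (c * a x)) = fun x => c * (k x * a x) by funext x; ring,
      intervalIntegral.integral_const_mul]
    ring
  · simp only [leftIntegralPoint, Pi.smul_apply, smul_eq_mul, map_mul]
    ring

/-- `pointRightIntegral` is pair-homogeneous. [cite: Zhang2022LandauSiegel, §7 Prop 7.1 (7.2)] -/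
theorem pairHomogeneous_pointRightIntegral (x₀ θ : ℝ) (k : ℝ → ℂ) :
    PairHomogeneous (pointRightIntegral x₀ θ k) := by
  refine ⟨fun c a a' b b' => ?_, fun c a a' b b' => ?_⟩
  · simp only [pointRightIntegral, Pi.smul_apply, smul_eq_mul]
    ring
  · simp only [pointRightIntegral, Pi.smul_apply, smul_eq_mul]
    rw [show (fun y => k y * (c * b y)) = fun y => c * (k y * b y) by funext y; ring,
      intervalIntegral.integral_const_mul, map_mul]
    ring

/-- Pair-homogeneity is preserved by sums. [cite: Zhang2022LandauSiegel, §7 Prop 7.1 (7.2)] -/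
theorem PairHomogeneous.add {X Y : PairFunctional} (hX : PairHomogeneous X) (hY : PairHomogeneous Y) :
    PairHomogeneous (X + Y) := by
  refine ⟨fun c a a' b b' => ?_, fun c a a' b b' => ?_⟩
  · simp only [Pi.add_apply, hX.1, hY.1]; ring
  · simp only [Pi.add_apply, hX.2, hY.2]; ring

/-- … by scalar multiples. [cite: Zhang2022LandauSiegel, §7 Prop 7.1 (7.2)] -/
theorem PairHomogeneous.const_mul {X : PairFunctional} (hX : PairHomogeneous X) (w : ℂ) :
    PairHomogeneous (fun f f' g g' => w * X f f' g g') := by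
  refine ⟨fun c a a' b b' => ?_, fun c a a' b b' => ?_⟩
  · simp only [hX.1]; ring
  · simp only [hX.2]; ring

/-- … by negation. [cite: Zhang2022LandauSiegel, §7 Prop 7.1 (7.2)] -/
theorem PairHomogeneous.neg {X : PairFunctional} (hX : PairHomogeneous X) : PairHomogeneous (-X) := by
  refine ⟨fun c a a' b b' => ?_, fun c a a' b b' => ?_⟩
  · simp only [Pi.neg_apply, hX.1]; ring
  · simp only [Pi.neg_apply, hX.2]; ring

/-- … and by finite sums. [cite: Zhang2022LandauSiegel, §7 Prop 7.1 (7.2)] -/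
theorem PairHomogeneous.sum {ι : Type*} (s : Finset ι) {X : ι → PairFunctional} (h : ∀ i ∈ s, PairHomogeneous (X i)) :
    PairHomogeneous (fun f f' g g' => ∑ i ∈ s, X i f f' g g') := by
  refine ⟨fun c a a' b b' => ?_, fun c a a' b b' => ?_⟩
  · rw [Finset.mul_sum]
    exact Finset.sum_congr rfl fun i hi => (h i hi).1 c a a' b b'
  · rw [Finset.mul_sum]
    exact Finset.sum_congr rfl fun i hi => (h i hi).2 c a a' b b'

/-- **So every table assembled from these shapes passes the α1 junk guard** (`vanishesOnZero_of_pairHomogeneous`): e.g. a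
kernel form plus an endpoint term. [cite: Zhang2022LandauSiegel, §7 Prop 7.1 (7.2)] -/
theorem vanishesOnZero_kernelPair_add_pointPair (θ₁ θ₂ : ℝ) (K₀₀ K₀₁ K₁₀ K₁₁ : ℝ → ℝ → ℂ) (w : ℂ) (x₀ y₀ : ℝ) :
    VanishesOnZero (kernelPair θ₁ θ₂ K₀₀ K₀₁ K₁₀ K₁₁ + pointPair w x₀ y₀) :=
  vanishesOnZero_of_pairHomogeneous
    ((pairHomogeneous_kernelPair θ₁ θ₂ K₀₀ K₀₁ K₁₀ K₁₁).add (pairHomogeneous_pointPair w x₀ y₀))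

end KernelForms

end Literature.NumberTheory.LFunctions.Zhang2022.KnifeEdge

end
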